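import Mathlib
import Summits.KontsevichZagierPeriods.Zeta5Search.Families.TransportCertificate
import HarnessLib

/-!
# ζ(5) search — Families: rational certificates for the growth constant `bzSup a` of a Brown–Zudilin ray

HONEST FRAMING: systematic search; no irrationality claim unless certified.  STRUCTURAL facts about the size of the
Brown–Zudilin cellular integrals `I(N·a)` [BrownZudilin2022, §2 (3)–(4)]; nothing about the arithmetic of any zeta value.

`Families/RayGrowthTransport.lean` (seat P2) proves the transport inequality
`bzSup(a)^q · ∏_i (Σ_w p(i,w))^{Σ_w p(i,w)} ≤ ∏ p(i,w)^{p(i,w)}` for every integer plan `p` of weight `q`, and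
`Families/TransportCertificate.lean` (seat P2) packages it as **`bzSup_le_of_natCert`**: a supported plan with the right
marginals and the natural-number CERTIFICATE INEQUALITY `den^q · ∏ p^p ≤ num^q · ∏ rows^rows` give `bzSup a ≤ num / den` —
decided by the kernel without ever spelling the numbers out (for the record direction at `q = 7560` both sides have
≈ 3·10⁶ digits; `decide +kernel`).  This file adds the other half and the consequences:

* **`le_bzSup_of_point`** — any point of the open simplex bounds `bzSup a` from below by the value of the integrand;
* `cellularIntegral_pos_of_converges`, `cellularIntegral_le_of_bzSup_le` — positivity and `I(N·a) ≤ U^N · I(0)`;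
* `log_bzSup_mem_Ioo_of_exp` / `_Icc_` — transfer of a two-sided enclosure to the logarithmic scale.

Instances (the record direction of [BrownZudilin2022, Thm. 1] to `10⁻⁸·⁵`, the direction of [§12], and the census
candidates of the `brown8` family) are in `Families/CellularBZRayGrowthConstants{,B}.lean`; the record DECAY RATE
`log|I(a·n)|/n → c ∈ (−66.05784568, −66.05784567)` (first clause of the named fact `BrownZudilin2022.record_rates`) is
`Families/CellularBZRecordDecayRate.lean`.  Cell `pub-zeta5`, class `fam-brown8` (g8).  Standard axioms only.
-/

noncomputable section

open Finset Filter Topology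

namespace Summit.KontsevichZagierPeriods.Zeta5Search.Families.Cellular

open Literature.NumberTheory.Irrationality

/-! ### Lower bounds: a point of the simplex -/

/-- **Lower certificate.**  For `a` in the cone (3) and any point `t` of the open simplex, a lower bound for the
integrand `f_{₈π₈^∨}(bzNum a, bzDen a)(t)` is a lower bound for `bzSup a`. -/
theorem le_bzSup_of_point {a : Fin 8 → ℤ} (ha : BrownZudilin2022.Converges a) {t : Fin 5 → ℝ}
    (ht : t ∈ openSimplex 5) {m : ℝ} (hm : m ≤ rayF pi8dual (bzNum a) (bzDen a) t) : m ≤ bzSup a :=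
  hm.trans (rayF_le_raySup pi8dual (bzNum a) (bzDen a) pi8dual_bijective (homogeneous_bz _)
    (brownConvergent_bz_ray ha) ht)

/-! ### Consequences of an enclosure -/

/-- The cellular integrals of a direction in the cone are positive. -/
theorem cellularIntegral_pos_of_converges {a : Fin 8 → ℤ} (h : BrownZudilin2022.Converges a) :
    0 < BrownZudilin2022.cellularIntegral a := by
  rw [← integral_bz]
  exact integral_pos_of_brownConvergent pi8dual (bzNum a) (bzDen a) (by norm_num) pi8dual_bijective
    (homogeneous_bz a) ((brownConvergent_bz_iff a).2 h)

/-- An upper bound `bzSup a ≤ U` gives `I(N·a) ≤ U^N · I(0)` for every `N`. -/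
theorem cellularIntegral_le_of_bzSup_le {a : Fin 8 → ℤ} (h : BrownZudilin2022.Converges a) {U : ℝ}
    (hU : bzSup a ≤ U) (N : ℕ) :
    BrownZudilin2022.cellularIntegral (fun i => (N : ℤ) * a i) ≤
      U ^ N * BrownZudilin2022.cellularIntegral (fun i => ((0 : ℕ) : ℤ) * a i) :=
  (cellularIntegral_le_bzSup_pow h N).trans
    (mul_le_mul_of_nonneg_right (pow_le_pow_left₀ (bzSup_pos h).le hU N)
      (cellularIntegral_pos_of_converges (converges_smul h le_rfl)).le)

/-- Transfer of an enclosure `L ≤ bzSup a ≤ U` to the logarithmic scale: `exp x < L` and `U < exp y` give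
`log bzSup a ∈ (x, y)`. -/
theorem log_bzSup_mem_Ioo_of_exp {a : Fin 8 → ℤ} (h : BrownZudilin2022.Converges a) {L U x y : ℝ}
    (hL : L ≤ bzSup a) (hU : bzSup a ≤ U) (hx : Real.exp x < L) (hy : U < Real.exp y) :
    Real.log (bzSup a) ∈ Set.Ioo x y := by
  have hpos := bzSup_pos h
  exact ⟨(Real.lt_log_iff_exp_lt hpos).2 (hx.trans_le hL), (Real.log_lt_iff_lt_exp hpos).2 (hU.trans_lt hy)⟩

/-- The same with closed inequalities: `exp x ≤ L ≤ bzSup a ≤ U ≤ exp y` gives `log bzSup a ∈ [x, y]`. -/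
theorem log_bzSup_mem_Icc_of_exp {a : Fin 8 → ℤ} (h : BrownZudilin2022.Converges a) {L U x y : ℝ}
    (hL : L ≤ bzSup a) (hU : bzSup a ≤ U) (hx : Real.exp x ≤ L) (hy : U ≤ Real.exp y) :
    Real.log (bzSup a) ∈ Set.Icc x y := by
  have hpos := bzSup_pos h
  exact ⟨(Real.le_log_iff_exp_le hpos).2 (hx.trans hL), (Real.log_le_iff_le_exp hpos).2 (hU.trans hy)⟩

end Summit.KontsevichZagierPeriods.Zeta5Search.Families.Cellular
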